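import Summits.CriticalPhenomena.PercolationContinuityZ3.Theorems.Transplant.FKThreeApexOmegaClosure1
import HarnessLib

/-!
# The three-apex monoid: the semigroup theorem for `Ω_q` — layer 3b: fibres, endpoints, and the assembly `Ω_q · Ω_q ⊆ Ω_q`

Helper file (`--supports stmt-CriticalPhenomena-4575`), FK sub-lane `prim-bschramm-fk-3` (gen 14); builds on p205010 (kernel theorem, internal audit
signed; external expert review pending).  No sorries; standard axioms.  Memo `bschramm/prim-bschramm-fk-3/DISJOINT-VIA-U.md` §2(v), §7 (B3)–(B5).

Fix `a ∈ Ω_q` and move the `ẑ`-coordinate of the other factor `h ∈ Ω_q` along its fibre: the weak conditions on `a·h` are affine in `ẑ(h)`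
(`OmW.interp`), so it suffices to treat the two ENDPOINTS of the fibre segment `{ζ : withZ h ζ ∈ Ω_q^w}`:
* the upper endpoint `ζ = ûv̂/max(x̂,ŷ)` is a (scaled) face point (`upper_endpoint`);
* the lower endpoint `ζ₀ = inf` (a minimum, the fibre set being closed) is the formal point `ζ₀ = 0`, or a (scaled) edge-ray point (`N^{(ac)} = 0` or
  `N^{(ab)} = 0`), or — by minimality and continuity — a point of the curved boundary, i.e. a scaled `bdPt q s τ` (`lower_endpoint`, using the boundary
  coordinates `eq_scale_bdPt`).
`reduce` packages this; applied four times (edge rays, diagonal, curved boundary, general) with the certified products of layer 3a it gives `Om.mul`,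
and, transferred to fibre-mass vectors, `InOmega.conv`: **`Ω_q` is closed under the gluing product** (`0 < q ≤ 1`). [folklore]
-/

noncomputable section

namespace Summit.CriticalPhenomena.PercolationContinuityZ3.Theorems

namespace FK

namespace ThreeApex

namespace H5

open Filter Topology

/-! ### Small algebra -/

/-- `withZ h h.z = h`. [folklore] -/
theorem withZ_self (h : H5) : withZ h h.z = h := rfl

/-- `mul a (scale l m b) = scale l m (mul a b)`. [folklore] -/
theorem mul_scale (l m : ℝ) (a b : H5) : mul a (scale l m b) = scale l m (mul a b) := by
  apply H5.ext <;> simp only [mul, scale] <;> ring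

/-- Scalings compose. [folklore] -/
theorem scale_scale (l m l' m' : ℝ) (h : H5) : scale l m (scale l' m' h) = scale (l * l') (m * m') h := by
  apply H5.ext <;> simp only [scale] <;> ring

/-- Weak membership is scale-invariant (positive scalings). [folklore] -/
theorem OmW.scale {q : ℝ} {h : H5} (hh : OmW q h) {l m : ℝ} (hl : 0 < l) (hm : 0 < m) : OmW q (H5.scale l m h) := by
  refine ⟨?_, ?_, ?_, ?_, ?_, ?_, ?_, ?_, fun w₁ w₂ hw₁ hw₂ => ?_⟩
  · simp only [H5.scale]; exact mul_pos hl hh.u_pos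
  · simp only [H5.scale]; exact mul_nonneg hm.le hh.z_nn
  · simp only [H5.scale]; exact mul_le_mul_of_nonneg_left hh.x_ge hl.le
  · simp only [H5.scale]; exact mul_le_mul_of_nonneg_left hh.y_ge hl.le
  · simp only [H5.scale]; nlinarith [hh.sxz, mul_pos hl hm]
  · simp only [H5.scale]; nlinarith [hh.syz, mul_pos hl hm]
  · rw [nab_scale]; have := hh.nab; positivity
  · rw [nac_scale]; have := hh.nac; positivity
  · rw [phi_scale]; have := hh.U w₁ w₂ hw₁ hw₂; positivity

/-! ### The fibre set of `h` -/

/-- The `ẑ`-values for which `withZ h ζ` satisfies the (non-constant) weak conditions. [folklore] -/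
def fib (q : ℝ) (h : H5) : Set ℝ :=
  {ζ | 0 ≤ ζ ∧ (h.x * ζ ≤ h.u * h.v ∧ (h.y * ζ ≤ h.u * h.v ∧ (0 ≤ nab q (withZ h ζ) ∧ (0 ≤ nac q (withZ h ζ) ∧
    ∀ w₁ w₂ : ℝ, 0 ≤ phi q |w₁| |w₂| (withZ h ζ)))))}

/-- Membership in the fibre set is weak membership of `withZ h ζ` (given the constant conditions). [folklore] -/
theorem mem_fib_iff {q : ℝ} {h : H5} (hu : 0 < h.u) (hx : h.u ≤ h.x) (hy : h.u ≤ h.y) {ζ : ℝ} :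
    ζ ∈ fib q h ↔ OmW q (withZ h ζ) := by
  constructor
  · rintro ⟨h0, h1, h2, h3, h4, h5⟩
    exact ⟨hu, h0, hx, hy, h1, h2, h3, h4, fun w₁ w₂ hw₁ hw₂ => by
      simpa [abs_of_nonneg hw₁, abs_of_nonneg hw₂] using h5 w₁ w₂⟩
  · intro W
    exact ⟨W.z_nn, W.sxz, W.syz, W.nab, W.nac, fun w₁ w₂ => W.U |w₁| |w₂| (abs_nonneg _) (abs_nonneg _)⟩

/-- The fibre set is closed. [folklore] -/
theorem isClosed_fib (q : ℝ) (h : H5) : IsClosed (fib q h) := by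
  have c1 : Continuous fun ζ : ℝ => nab q (withZ h ζ) := by simp only [nab, withZ]; fun_prop
  have c2 : Continuous fun ζ : ℝ => nac q (withZ h ζ) := by simp only [nac, withZ]; fun_prop
  have c3 : ∀ w₁ w₂ : ℝ, Continuous fun ζ : ℝ => phi q |w₁| |w₂| (withZ h ζ) := fun w₁ w₂ => by
    simp only [phi, nab, nac, ja, withZ]; fun_prop
  simp only [fib, Set.setOf_and, Set.setOf_forall]
  exact (isClosed_le continuous_const continuous_id).inter ((isClosed_le (by fun_prop) continuous_const).inter
    ((isClosed_le (by fun_prop) continuous_const).inter ((isClosed_le continuous_const c1).inter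
    ((isClosed_le continuous_const c2).inter (isClosed_iInter fun w₁ => isClosed_iInter fun w₂ =>
      isClosed_le continuous_const (c3 w₁ w₂))))))

/-- The fibre set is bounded below (by `0`). [folklore] -/
theorem bddBelow_fib (q : ℝ) (h : H5) : BddBelow (fib q h) := ⟨0, fun _ hζ => hζ.1⟩

/-- A member's own `ẑ` is in its fibre set. [folklore] -/
theorem Om.z_mem_fib {q : ℝ} {h : H5} (hh : Om q h) : h.z ∈ fib q h :=
  (mem_fib_iff hh.u_pos hh.x_ge hh.y_ge).2 (by rw [withZ_self]; exact hh.toW)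

/-! ### The edge-ray endpoints -/

/-- A weak member with `ẑ > 0` and `N^{(ac)} = 0` is a scaled ab-edge-ray point (`0 < q ≤ 1`). [folklore] -/
theorem OmW.eq_edge_of_nac {q : ℝ} (hq0 : 0 < q) (hq1 : q ≤ 1) {p : H5} (hp : OmW q p) (hz : 0 < p.z) (hn : H5.nac q p = 0) :
    0 ≤ p.x / p.u - 1 ∧ p = H5.scale p.u p.z (face1Pt 0 (p.x / p.u - 1)) := by
  have hu := hp.u_pos
  have hx : 0 < p.x := lt_of_lt_of_le hu hp.x_ge
  have hv : 0 < p.v := by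
    have := hp.sxz; by_contra hv; have hv' : p.v ≤ 0 := not_lt.1 hv; nlinarith [mul_pos hx hz]
  have hzv : p.z ≤ p.v := by
    have := hp.sxz
    have : p.u * p.z ≤ p.u * p.v := le_trans (mul_le_mul_of_nonneg_right hp.x_ge hz.le) this
    exact le_of_mul_le_mul_left this hu
  have hja : 0 ≤ H5.ja p := by
    rcases hp.ja_or_det hq1 with h | h
    · exact h
    · rw [hn, mul_zero] at h
      have : ((2 - q) * H5.ja p) ^ 2 = 0 := le_antisymm h (sq_nonneg _)
      have hp2 : (2 - q) ≠ 0 := by intro h0; linarith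
      have : H5.ja p = 0 := by simpa [hp2] using pow_eq_zero_iff (n := 2) (by norm_num) |>.1 this
      rw [this]
  -- `v̂·J = (v̂ − (1−q)ẑ)(x̂ẑ − ûv̂) + ẑ·N^{(ac)}`
  have e : p.v * H5.ja p = (p.v - (1 - q) * p.z) * (p.x * p.z - p.u * p.v) + p.z * H5.nac q p := by
    simp only [H5.ja, H5.nac]; ring
  rw [hn, mul_zero, add_zero] at e
  have hf : 0 < p.v - (1 - q) * p.z := by nlinarith
  have hxz : p.x * p.z = p.u * p.v := by
    have h1 : 0 ≤ p.v * H5.ja p := mul_nonneg hv.le hja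
    have h2 : (p.v - (1 - q) * p.z) * (p.x * p.z - p.u * p.v) ≤ 0 :=
      mul_nonpos_of_nonneg_of_nonpos hf.le (by linarith [hp.sxz])
    have h3 : (p.v - (1 - q) * p.z) * (p.x * p.z - p.u * p.v) = 0 := le_antisymm h2 (e ▸ h1)
    rcases mul_eq_zero.1 h3 with h4 | h4
    · exact absurd h4 hf.ne'
    · linarith
  have hy : p.y = p.u := by
    have : p.v * (p.y - p.u) = 0 := by
      have e2 : H5.nac q p = p.v * (p.y - p.u) + (1 - q) * (p.x * p.z - p.u * p.v) := by simp only [H5.nac]; ring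
      rw [hn, hxz, sub_self, mul_zero, add_zero] at e2; exact e2.symm
    rcases mul_eq_zero.1 this with h4 | h4
    · exact absurd h4 hv.ne'
    · linarith
  refine ⟨by rw [sub_nonneg, le_div_iff₀ hu]; simpa using hp.x_ge, ?_⟩
  apply H5.ext <;> simp only [H5.scale, face1Pt]
  · ring
  · field_simp; ring
  · rw [hy]; ring
  · ring
  · rw [show (1:ℝ) + 0 + (p.x / p.u - 1) = p.x / p.u by ring, ← mul_div_assoc, _root_.mul_comm p.z p.x, hxz, mul_div_cancel_left₀ _ hu.ne']

/-! ### The endpoints of a fibre -/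

/-- **Upper endpoint.** `ζ₁ = ûv̂ / max(x̂,ŷ) ≥ ẑ`, and `withZ h ζ₁` is a scaled face point. [folklore] -/
theorem Om.upper_endpoint {q : ℝ} {h : H5} (hh : Om q h) :
    ∃ ζ₁ : ℝ, h.z ≤ ζ₁ ∧
      ((∃ b₁ a₁ l m : ℝ, 0 ≤ b₁ ∧ 0 ≤ a₁ ∧ 0 < l ∧ 0 < m ∧ withZ h ζ₁ = H5.scale l m (face1Pt b₁ a₁)) ∨
       (∃ b₂ a₂ l m : ℝ, 0 ≤ b₂ ∧ 0 ≤ a₂ ∧ 0 < l ∧ 0 < m ∧ withZ h ζ₁ = H5.scale l m (face2Pt b₂ a₂))) := by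
  have hu := hh.u_pos
  have hv := hh.v_pos
  have hx : 0 < h.x := lt_of_lt_of_le hu hh.x_ge
  have hy : 0 < h.y := lt_of_lt_of_le hu hh.y_ge
  rcases le_total h.y h.x with hyx | hxy
  · refine ⟨h.u * h.v / h.x, by rw [le_div_iff₀ hx]; linarith [hh.sxz], Or.inl ⟨h.y / h.u - 1, (h.x - h.y) / h.u, h.u, h.u * h.v / h.x,
      by rw [sub_nonneg, le_div_iff₀ hu]; simpa using hh.y_ge, div_nonneg (by linarith) hu.le, hu, by positivity, ?_⟩⟩
    apply H5.ext <;> simp only [withZ, H5.scale, face1Pt] <;> field_simp <;> ring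
  · refine ⟨h.u * h.v / h.y, by rw [le_div_iff₀ hy]; linarith [hh.syz], Or.inr ⟨h.x / h.u - 1, (h.y - h.x) / h.u, h.u, h.u * h.v / h.y,
      by rw [sub_nonneg, le_div_iff₀ hu]; simpa using hh.x_ge, div_nonneg (by linarith) hu.le, hu, by positivity, ?_⟩⟩
    apply H5.ext <;> simp only [withZ, H5.scale, face2Pt] <;> field_simp <;> ring

/-- **Lower endpoint.** The infimum `ζ₀` of the fibre set is attained, `0 ≤ ζ₀ ≤ ẑ`, and `withZ h ζ₀` is the formal point `ζ₀ = 0`, a scaled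
edge-ray point, or a scaled curved-boundary point `bdPt q s τ` (`0 < s ≤ 1`, `τ > 0`). [folklore] -/
theorem Om.lower_endpoint {q : ℝ} (hq0 : 0 < q) (hq1 : q ≤ 1) {h : H5} (hh : Om q h) :
    ∃ ζ₀ : ℝ, 0 ≤ ζ₀ ∧ ζ₀ ≤ h.z ∧ OmW q (withZ h ζ₀) ∧
      (ζ₀ = 0 ∨
       (∃ e l m : ℝ, 0 ≤ e ∧ 0 < l ∧ 0 < m ∧ withZ h ζ₀ = H5.scale l m (face1Pt 0 e)) ∨
       (∃ e l m : ℝ, 0 ≤ e ∧ 0 < l ∧ 0 < m ∧ withZ h ζ₀ = H5.scale l m (face2Pt 0 e)) ∨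
       (∃ s t l m : ℝ, 0 < s ∧ s ≤ 1 ∧ 0 < t ∧ 0 < l ∧ 0 < m ∧ withZ h ζ₀ = H5.scale l m (bdPt q s t))) := by
  have hu := hh.u_pos
  have hv := hh.v_pos
  have hx : 0 < h.x := lt_of_lt_of_le hu hh.x_ge
  have hy : 0 < h.y := lt_of_lt_of_le hu hh.y_ge
  have hfib := fun ζ => (mem_fib_iff (q := q) hh.u_pos hh.x_ge hh.y_ge (ζ := ζ))
  set S := fib q h
  have hne : S.Nonempty := ⟨h.z, hh.z_mem_fib⟩
  have hbdd := bddBelow_fib q h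
  set ζ₀ := sInf S
  have hmem : ζ₀ ∈ S := (isClosed_fib q h).csInf_mem hne hbdd
  have hle : ∀ ζ ∈ S, ζ₀ ≤ ζ := fun ζ hζ => csInf_le hbdd hζ
  have W0 : OmW q (withZ h ζ₀) := (hfib ζ₀).1 hmem
  have h0 : 0 ≤ ζ₀ := hmem.1
  refine ⟨ζ₀, h0, hle _ hh.z_mem_fib, W0, ?_⟩
  rcases h0.eq_or_lt with hz0 | hpos
  · exact Or.inl hz0.symm
  right
  by_cases hnac : H5.nac q (withZ h ζ₀) = 0
  · obtain ⟨he, E⟩ := W0.eq_edge_of_nac hq0 hq1 hpos hnac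
    exact Or.inl ⟨_, _, _, he, hu, hpos, E⟩
  by_cases hnab : H5.nab q (withZ h ζ₀) = 0
  · have W0' := W0.swapXY
    obtain ⟨he, E⟩ := W0'.eq_edge_of_nac hq0 hq1 (by simpa [H5.swapXY, withZ] using hpos) (by rwa [nac_swapXY])
    refine Or.inr (Or.inl ⟨_, _, _, he, by simpa [H5.swapXY, withZ] using hu, by simpa [H5.swapXY, withZ] using hpos, ?_⟩)
    have := congrArg H5.swapXY E
    rw [swapXY_swapXY, swapXY_scale, swapXY_face1Pt] at this
    simpa [H5.swapXY, withZ] using this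
  right; right
  -- the curved-boundary case: minimality forces `J_a < 0` and the determinant equality
  have hnab' : 0 < H5.nab q (withZ h ζ₀) := lt_of_le_of_ne W0.nab (Ne.symm hnab)
  have hnac' : 0 < H5.nac q (withZ h ζ₀) := lt_of_le_of_ne W0.nac (Ne.symm hnac)
  have hclaim : H5.ja (withZ h ζ₀) < 0 ∧ ((2 - q) * H5.ja (withZ h ζ₀)) ^ 2 = 4 * H5.nab q (withZ h ζ₀) * H5.nac q (withZ h ζ₀) := by
    by_contra hcon
    have hopen : 0 < H5.ja (withZ h ζ₀) ∨
        ((2 - q) * H5.ja (withZ h ζ₀)) ^ 2 < 4 * H5.nab q (withZ h ζ₀) * H5.nac q (withZ h ζ₀) := by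
      have h4 : 0 < 4 * H5.nab q (withZ h ζ₀) * H5.nac q (withZ h ζ₀) := by positivity
      rcases W0.ja_or_det hq1 with hj | hd
      · rcases hj.lt_or_eq with hj' | hj'
        · exact Or.inl hj'
        · right; rw [← hj']; simpa using h4
      · rcases hd.lt_or_eq with hd' | hd'
        · exact Or.inr hd'
        · have hj : 0 ≤ H5.ja (withZ h ζ₀) := by
            by_contra hj; exact hcon ⟨lt_of_not_ge hj, hd'⟩
          rcases hj.lt_or_eq with hj' | hj'
          · exact Or.inl hj'
          · right; rw [← hj']; simpa using h4
    have c1 : Continuous fun ζ : ℝ => H5.nab q (withZ h ζ) := by simp only [H5.nab, withZ]; fun_prop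
    have c2 : Continuous fun ζ : ℝ => H5.nac q (withZ h ζ) := by simp only [H5.nac, withZ]; fun_prop
    have c3 : Continuous fun ζ : ℝ => H5.ja (withZ h ζ) := by simp only [H5.ja, withZ]; fun_prop
    have c4 : Continuous fun ζ : ℝ => 4 * H5.nab q (withZ h ζ) * H5.nac q (withZ h ζ) - ((2 - q) * H5.ja (withZ h ζ)) ^ 2 := by
      simp only [H5.nab, H5.nac, H5.ja, withZ]; fun_prop
    have ev1 : ∀ᶠ ζ in 𝓝 ζ₀, 0 < H5.nab q (withZ h ζ) := c1.continuousAt.eventually (lt_mem_nhds hnab')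
    have ev2 : ∀ᶠ ζ in 𝓝 ζ₀, 0 < H5.nac q (withZ h ζ) := c2.continuousAt.eventually (lt_mem_nhds hnac')
    have ev3 : ∀ᶠ ζ in 𝓝 ζ₀, 0 < H5.ja (withZ h ζ) ∨
        ((2 - q) * H5.ja (withZ h ζ)) ^ 2 < 4 * H5.nab q (withZ h ζ) * H5.nac q (withZ h ζ) := by
      rcases hopen with hj | hd
      · exact (c3.continuousAt.eventually (lt_mem_nhds hj)).mono fun ζ hζ => Or.inl hζ
      · have hd0 : (0 : ℝ) < 4 * H5.nab q (withZ h ζ₀) * H5.nac q (withZ h ζ₀) - ((2 - q) * H5.ja (withZ h ζ₀)) ^ 2 := by linarith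
        exact (c4.continuousAt.eventually (lt_mem_nhds hd0)).mono fun ζ hζ => Or.inr (by linarith)
    obtain ⟨ε, hε, hball⟩ := Metric.eventually_nhds_iff.1 ((ev1.and ev2).and ev3)
    set δ := min (ε / 2) (ζ₀ / 2) with hδdef
    have hδ : 0 < δ := lt_min (by linarith) (by linarith)
    have hδ1 : δ ≤ ε / 2 := min_le_left _ _
    have hδ2 : δ ≤ ζ₀ / 2 := min_le_right _ _
    have hdist : dist (ζ₀ - δ) ζ₀ < ε := by
      rw [Real.dist_eq, show ζ₀ - δ - ζ₀ = -δ by ring, abs_neg, abs_of_pos hδ]; linarith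
    obtain ⟨⟨g1, g2⟩, g3⟩ := hball hdist
    have hmem' : ζ₀ - δ ∈ S := by
      refine (hfib _).2 ⟨hu, (by linarith : 0 ≤ ζ₀ - δ), hh.x_ge, hh.y_ge, ?_, ?_, g1.le, g2.le, fun w₁ w₂ hw₁ hw₂ => ?_⟩
      · show h.x * (ζ₀ - δ) ≤ h.u * h.v
        have := W0.sxz; simp only [withZ] at this; nlinarith
      · show h.y * (ζ₀ - δ) ≤ h.u * h.v
        have := W0.syz; simp only [withZ] at this; nlinarith
      · rcases g3 with gj | gd
        · have hp : 0 ≤ 2 - q := by linarith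
          have := g1.le; have := g2.le; have := gj.le
          simp only [H5.phi]; positivity
        · simpa only [H5.phi] using quad_nonneg g1.le g2.le gd.le w₁ w₂
    have := hle _ hmem'
    linarith
  obtain ⟨hja, hD⟩ := hclaim
  -- the boundary parameter `τ = √(N^{(ab)}/N^{(ac)})`
  obtain ⟨τ, hτ, hτ2⟩ : ∃ τ : ℝ, 0 < τ ∧ τ ^ 2 * H5.nac q (withZ h ζ₀) = H5.nab q (withZ h ζ₀) :=
    ⟨Real.sqrt (H5.nab q (withZ h ζ₀) / H5.nac q (withZ h ζ₀)), Real.sqrt_pos.2 (div_pos hnab' hnac'), by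
      rw [Real.sq_sqrt (div_pos hnab' hnac').le]; field_simp⟩
  have h1 : H5.nab q (withZ h ζ₀) - τ ^ 2 * H5.nac q (withZ h ζ₀) = 0 := by linarith
  have h2 : 2 * τ * H5.nac q (withZ h ζ₀) + (2 - q) * H5.ja (withZ h ζ₀) = 0 := by
    have hprod : ((2 - q) * H5.ja (withZ h ζ₀) + 2 * τ * H5.nac q (withZ h ζ₀)) *
        ((2 - q) * H5.ja (withZ h ζ₀) - 2 * τ * H5.nac q (withZ h ζ₀)) = 0 := by
      have e : ((2 - q) * H5.ja (withZ h ζ₀) + 2 * τ * H5.nac q (withZ h ζ₀)) * ((2 - q) * H5.ja (withZ h ζ₀) - 2 * τ * H5.nac q (withZ h ζ₀))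
          = ((2 - q) * H5.ja (withZ h ζ₀)) ^ 2 - 4 * (τ ^ 2 * H5.nac q (withZ h ζ₀)) * H5.nac q (withZ h ζ₀) := by ring
      rw [e, hτ2, hD]; ring
    rcases mul_eq_zero.1 hprod with h3 | h3
    · linarith
    · exfalso
      have : 0 < 2 * τ * H5.nac q (withZ h ζ₀) := by positivity
      have hp : 0 < 2 - q := by linarith
      have : (2 - q) * H5.ja (withZ h ζ₀) < 0 := mul_neg_of_pos_of_neg hp hja
      linarith
  -- normalise `v̂ = 1`
  set p₁ := H5.scale 1 h.v⁻¹ (withZ h ζ₀) with hp₁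
  have hv1 : p₁.v = 1 := by simp [hp₁, H5.scale, withZ, hv.ne']
  have hzp : p₁.z = ζ₀ / h.v := by simp [hp₁, H5.scale, withZ, div_eq_inv_mul]
  have hup : p₁.u = h.u := by simp [hp₁, H5.scale, withZ]
  have h1' : H5.nab q p₁ - τ ^ 2 * H5.nac q p₁ = 0 := by
    rw [hp₁, nab_scale, nac_scale, show 1 * h.v⁻¹ * H5.nab q (withZ h ζ₀) - τ ^ 2 * (1 * h.v⁻¹ * H5.nac q (withZ h ζ₀))
      = h.v⁻¹ * (H5.nab q (withZ h ζ₀) - τ ^ 2 * H5.nac q (withZ h ζ₀)) by ring, h1, mul_zero]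
  have h2' : 2 * τ * H5.nac q p₁ + (2 - q) * ja p₁ = 0 := by
    rw [hp₁, nac_scale, ja_scale, show 2 * τ * (1 * h.v⁻¹ * H5.nac q (withZ h ζ₀)) + (2 - q) * (1 * h.v⁻¹ * H5.ja (withZ h ζ₀))
      = h.v⁻¹ * (2 * τ * H5.nac q (withZ h ζ₀) + (2 - q) * H5.ja (withZ h ζ₀)) by ring, h2, mul_zero]
  have hs0 : 0 < p₁.z := by rw [hzp]; positivity
  have hs1 : p₁.z ≤ 1 := by
    rw [hzp, div_le_one hv]
    have e1 := W0.sxz; simp only [withZ] at e1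
    nlinarith [mul_le_mul_of_nonneg_right hh.x_ge hpos.le]
  have hDne : Big.bdD q p₁.z τ ≠ 0 := (bdD_pos hq1 hs0 hτ.le).ne'
  have hvz : p₁.v - (1 - q) * p₁.z ≠ 0 := by
    rw [hv1]; have : (1 - q) * p₁.z ≤ (1 - q) * 1 := mul_le_mul_of_nonneg_left hs1 (by linarith); nlinarith
  set s := p₁.z with hsdef
  set l := p₁.u / Big.bdD q s τ with hldef
  have hl : 0 < l := div_pos (by rw [hup]; exact hu) (bdD_pos hq1 hs0 hτ.le)
  have E : p₁ = H5.scale l 1 (bdPt q s τ) := eq_scale_bdPt hv1 h1' h2' hDne hvz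
  refine ⟨s, τ, l, h.v, hs0, hs1, hτ, hl, hv, ?_⟩
  calc withZ h ζ₀ = H5.scale 1 h.v p₁ := by
        apply H5.ext <;> simp only [hp₁, H5.scale, withZ] <;> field_simp
    _ = H5.scale l h.v (bdPt q s τ) := by rw [E, scale_scale]; simp

/-! ### The reduction to endpoints -/

/-- **Reduction.** If `a ∈ Ω_q` maps every face point and every curved-boundary point into weak `Ω_q`, then `a · h ∈ Ω_q` for every `h ∈ Ω_q`
(`0 < q ≤ 1`): move `ẑ(h)` to the endpoints of its fibre and interpolate. [folklore] -/
theorem Om.reduce {q : ℝ} (hq0 : 0 < q) (hq1 : q ≤ 1) {a h : H5} (ha : Om q a) (hh : Om q h)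
    (Hface1 : ∀ b₁ a₁ : ℝ, 0 ≤ b₁ → 0 ≤ a₁ → OmW q (mul a (face1Pt b₁ a₁)))
    (Hface2 : ∀ b₂ a₂ : ℝ, 0 ≤ b₂ → 0 ≤ a₂ → OmW q (mul a (face2Pt b₂ a₂)))
    (Hbd : ∀ s t : ℝ, 0 < s → s ≤ 1 → 0 < t → OmW q (mul a (bdPt q s t))) : Om q (mul a h) := by
  obtain ⟨ζ₀, h0, h0z, W0, hcases⟩ := hh.lower_endpoint hq0 hq1
  obtain ⟨ζ₁, hz1, hcases1⟩ := hh.upper_endpoint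
  have L : OmW q (mul a (withZ h ζ₀)) := by
    rcases hcases with hz | ⟨e, l, m, he, hl, hm, E⟩ | ⟨e, l, m, he, hl, hm, E⟩ | ⟨s, t, l, m, hs, hs1, ht, hl, hm, E⟩
    · rw [H5.mul_comm]; exact OmW.zero_mul hq1 W0 hz hh.v_pos ha.toW ha.v_pos
    · rw [E, mul_scale]; exact (Hface1 0 e le_rfl he).scale hl hm
    · rw [E, mul_scale]; exact (Hface2 0 e le_rfl he).scale hl hm
    · rw [E, mul_scale]; exact (Hbd s t hs hs1 ht).scale hl hm
  have R : OmW q (mul a (withZ h ζ₁)) := by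
    rcases hcases1 with ⟨b₁, a₁, l, m, h1, h2, hl, hm, E⟩ | ⟨b₂, a₂, l, m, h1, h2, hl, hm, E⟩
    · rw [E, mul_scale]; exact (Hface1 b₁ a₁ h1 h2).scale hl hm
    · rw [E, mul_scale]; exact (Hface2 b₂ a₂ h1 h2).scale hl hm
  have hzz : 0 < a.z * h.z := mul_pos ha.z_pos hh.z_pos
  rcases (h0z.trans hz1).eq_or_lt with heq | hlt
  · have hz0 : h.z = ζ₀ := le_antisymm (heq ▸ hz1) h0z
    have e : h = withZ h ζ₀ := by rw [← hz0]; rfl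
    rw [e]; exact L.toOm (by show 0 < a.z * ζ₀; rw [← hz0]; exact hzz)
  · set θ := (h.z - ζ₀) / (ζ₁ - ζ₀) with hθ
    have hd : 0 < ζ₁ - ζ₀ := by linarith
    have hθ0 : 0 ≤ θ := div_nonneg (by linarith) hd.le
    have hθ1 : θ ≤ 1 := (div_le_one hd).2 (by linarith)
    have e : (1 - θ) * ζ₀ + θ * ζ₁ = h.z := by rw [hθ]; field_simp; ring
    have := OmW.interp hθ0 hθ1 L R (by rw [e]; exact hzz)
    rwa [e] at this

/-! ### The assembly -/

/-- `a · (ab-edge ray) ∈ Ω_q` for every `a ∈ Ω_q`. [folklore] -/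
theorem Om.mul_edgePt {q : ℝ} (hq0 : 0 < q) (hq1 : q ≤ 1) {a : H5} (ha : Om q a) {e : ℝ} (he : 0 ≤ e) : Om q (mul a (edgePt e)) := by
  rw [H5.mul_comm]
  refine (edgePt_om hq0.le he).reduce hq0 hq1 ha ?_ ?_ ?_
  · intro b₁ a₁ h1 h2; rw [edgePt_eq_face1Pt]; exact (om_face1_mul_face1 hq0.le hq1 le_rfl he h1 h2).toW
  · intro b₂ a₂ h1 h2; rw [edgePt_eq_face1Pt]; exact (om_face1_mul_face2 hq0.le hq1 le_rfl he h1 h2).toW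
  · intro s t hs hs1 ht; rw [H5.mul_comm]; exact (om_bd_mul_edge hq0.le hq1 hs hs1 ht he).toW

/-- `a · Δ ∈ Ω_q` for every `a ∈ Ω_q`. [folklore] -/
theorem Om.mul_diagPt {q : ℝ} (hq0 : 0 < q) (hq1 : q ≤ 1) {a : H5} (ha : Om q a) {b : ℝ} (hb : 0 ≤ b) : Om q (mul a (diagPt b)) := by
  rw [H5.mul_comm]
  refine (diagPt_om hq1 hb).reduce hq0 hq1 ha ?_ ?_ ?_
  · intro b₁ a₁ h1 h2; rw [diagPt_eq_face1Pt]; exact (om_face1_mul_face1 hq0.le hq1 hb le_rfl h1 h2).toW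
  · intro b₂ a₂ h1 h2; rw [diagPt_eq_face2Pt]; exact (om_face2_mul_face2 hq0.le hq1 hb le_rfl h1 h2).toW
  · intro s t hs hs1 ht; rw [H5.mul_comm]; exact (om_bd_mul_diag hq0.le hq1 hs hs1 ht hb).toW

/-- `a · T1 ⊆ Ω_q` for every `a ∈ Ω_q` (a face point is edge ray · diagonal). [folklore] -/
theorem Om.mul_face1Pt {q : ℝ} (hq0 : 0 < q) (hq1 : q ≤ 1) {a : H5} (ha : Om q a) {b₁ a₁ : ℝ} (h1 : 0 ≤ b₁) (h2 : 0 ≤ a₁) :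
    Om q (mul a (face1Pt b₁ a₁)) := by
  have hb : (1 + b₁) ≠ 0 := by positivity
  rw [face1Pt_eq_mul a₁ hb, ← H5.mul_assoc]
  exact (ha.mul_edgePt hq0 hq1 (by positivity)).mul_diagPt hq0 hq1 h1

/-- `a · T2 ⊆ Ω_q` for every `a ∈ Ω_q` (by the symmetry `x̂ ↔ ŷ`). [folklore] -/
theorem Om.mul_face2Pt {q : ℝ} (hq0 : 0 < q) (hq1 : q ≤ 1) {a : H5} (ha : Om q a) {b₂ a₂ : ℝ} (h1 : 0 ≤ b₂) (h2 : 0 ≤ a₂) :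
    Om q (mul a (face2Pt b₂ a₂)) := by
  have := (ha.swapXY.mul_face1Pt hq0 hq1 h1 h2).swapXY
  rwa [swapXY_mul, swapXY_swapXY, swapXY_face1Pt] at this

/-- `a · C ⊆ Ω_q` for every `a ∈ Ω_q`. [folklore] -/
theorem Om.mul_bdPt {q : ℝ} (hq0 : 0 < q) (hq1 : q ≤ 1) {a : H5} (ha : Om q a) {s t : ℝ} (hs : 0 < s) (hs1 : s ≤ 1) (ht : 0 < t) :
    Om q (mul a (bdPt q s t)) := by
  rw [H5.mul_comm]
  have hc := bdPt_om hq0.le hq1 hs hs1 ht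
  refine hc.reduce hq0 hq1 ha ?_ ?_ ?_
  · intro b₁ a₁ h1 h2; exact (hc.mul_face1Pt hq0 hq1 h1 h2).toW
  · intro b₂ a₂ h1 h2; exact (hc.mul_face2Pt hq0 hq1 h1 h2).toW
  · intro s' t' hs' hs1' ht'; exact (om_bd_mul_bd hq0.le hq1 hs hs1 hs' hs1' ht ht').toW

/-- **The semigroup theorem** (hat form): `Ω_q · Ω_q ⊆ Ω_q` for `0 < q ≤ 1`. [folklore] -/
theorem Om.mul {q : ℝ} (hq0 : 0 < q) (hq1 : q ≤ 1) {a h : H5} (ha : Om q a) (hh : Om q h) : Om q (H5.mul a h) :=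
  ha.reduce hq0 hq1 hh (fun _ _ h1 h2 => (ha.mul_face1Pt hq0 hq1 h1 h2).toW) (fun _ _ h1 h2 => (ha.mul_face2Pt hq0 hq1 h1 h2).toW)
    fun _ _ hs hs1 ht => (ha.mul_bdPt hq0 hq1 hs hs1 ht).toW

end H5

/-- **The semigroup theorem**: `Ω_q` is closed under the gluing product `conv` of fibre-mass vectors (`0 < q ≤ 1`).  With `IsLetter.inOmega`
(layer 1) every word of the three-apex monoid lies in `Ω_q`, whence `(U_a)` and `T5` (`rayleigh_T5_nonneg_of_UCond`). [folklore] -/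
theorem InOmega.conv {q : ℝ} (hq0 : 0 < q) (hq1 : q ≤ 1) {z Z : V5} (hz : InOmega q z) (hZ : InOmega q Z) : InOmega q (conv z Z) := by
  rw [H5.om_ofV_iff] at hz hZ ⊢
  rw [H5.ofV_conv]
  exact hz.mul hq0 hq1 hZ

end ThreeApex

end FK

end Summit.CriticalPhenomena.PercolationContinuityZ3.Theorems
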